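import Mathlib
import Literature.Analysis.FluidPDE.IsometryInvariance
import Literature.Geometry.DiscreteGeometry.LayerShells
import Summits.NavierStokesRegularity.NavierStokesRegularity.Theorems.ThreadingFluxHorizonTowerZonalForm
import HarnessLib
/-!
# Crux `PoloidalLiouville` (stmt-NavierStokesRegularity-1222, wall W1), crux idea «horizon-threading-tower» (ns-idea-15):
# ALL-DEGREE horizon zonality, kernel part F2 — the orthonormal frame, the rotated function, and the back-transfer

Support file (Theorems-side tooling; seat ns-wall-eng-5 g4, cell ns-wall-extremal, W1 adjunct; `--supports stmt-NavierStokesRegularity-1222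
--as helper`).  Memo of record: pub/ns-wall-extremal/ARM-B/zonal-eng5/PROOF-HZSD-ALL-L.md (DATUM B-w5.8; paper proof critic-replicated by
ns-wall-crit-1 g2 2026-08-28T22:52:10Z); one-file kernel proof AllDev-HorizonZonalitySingleDegree.lean 53719c2c2d5f6cf4 of which this is a slice.

Content (kernel plan F2): the FRAME of an orthonormal pair `u ⊥ v`: `frameVec = (u, v, u × v)` is orthonormal (`orthonormal_frameVec`), an
`OrthonormalBasis` (`frameBasis`) and a linear isometry `frameIso = frameBasis.repr : ℝ³ ≃ ℝ³` (`w ↦ (⟪u,w⟫, ⟪v,w⟫, ⟪u×v,w⟫)`, inverse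
`y ↦ y₀u + y₁v + y₂(u×v)`); the triple-product identity `inner_cross_frameIso` (product of determinants); the rotated function `K = H ∘ R⁻¹`
keeps smoothness, homogeneity, harmonicity (Literature `laplacian_comp_linearIsometryEquiv_symm`), gradients transform by `R` (Literature
`gradient_comp_linearIsometryEquiv_symm`), det-zonality is preserved (`detZonal_comp_frameIso_symm`), and ★ `inner_cross_gradient_of_frame`:
rotation invariance of `K` about `e₂` gives rotation invariance of `H` about `u × v`.

HONEST LABEL: a lemma toward / part of the kernel proof of the crux-idea obstruction `HorizonTower.HorizonZonalitySingleDegree` (all `l`);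
`PoloidalLiouville` (1222), `UnthreadedRigidity` (27585), the NS-dynamics levers `OrderTwoHorizonLaw(Blowdown)` and NS regularity remain OPEN
and untouched; W1/W2 movement 0.  [folklore]
-/

-- the summit and its single problem share the name (D-0017 nested layout)
set_option linter.dupNamespace false

noncomputable section

open scoped RealInnerProductSpace
open Literature.Analysis.FluidPDE (cross)
open Literature.Geometry.DiscreteGeometry (inner_fin3 norm_sq_fin3)

namespace Summit.NavierStokesRegularity.NavierStokesRegularity.Theorems.PoloidalLiouville.HorizonTower.Zonal

section Frame

variable {u v : E3}

/-- The frame `(u, v, u × v)` as a family. -/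
def frameVec (u v : E3) : Fin 3 → E3 := ![u, v, cross u v]

/-- First frame vector `u`. [folklore] -/
@[simp] theorem frameVec_zero (u v : E3) : frameVec u v 0 = u := rfl
/-- Second frame vector `v`. [folklore] -/
@[simp] theorem frameVec_one (u v : E3) : frameVec u v 1 = v := rfl
/-- Third frame vector `u × v`. [folklore] -/
@[simp] theorem frameVec_two (u v : E3) : frameVec u v 2 = cross u v := rfl

/-- `u × v ⊥ u`. -/
theorem inner_cross_self_left (u v : E3) : ⟪cross u v, u⟫ = 0 := by
  obtain ⟨c0, c1, c2⟩ := cross_fin3 u v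
  rw [inner_fin3, c0, c1, c2]; ring

/-- `u × v ⊥ v`. -/
theorem inner_cross_self_right (u v : E3) : ⟪cross u v, v⟫ = 0 := by
  obtain ⟨c0, c1, c2⟩ := cross_fin3 u v
  rw [inner_fin3, c0, c1, c2]; ring

/-- Lagrange: `‖u × v‖² = ‖u‖²‖v‖² − ⟪u,v⟫²`. -/
theorem norm_cross_sq (u v : E3) : ‖cross u v‖ ^ 2 = ‖u‖ ^ 2 * ‖v‖ ^ 2 - ⟪u, v⟫ ^ 2 := by
  obtain ⟨c0, c1, c2⟩ := cross_fin3 u v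
  rw [norm_sq_fin3, norm_sq_fin3, norm_sq_fin3, inner_fin3, c0, c1, c2]; ring

/-- For orthonormal `u, v`: `(u × v) × u = v`. -/
theorem cross_cross_left_of_orthonormal (hu : ‖u‖ = 1) (huv : ⟪u, v⟫ = 0) : cross (cross u v) u = v := by
  have hu2 : u 0 ^ 2 + u 1 ^ 2 + u 2 ^ 2 = 1 := by rw [← norm_sq_fin3, hu, one_pow]
  have huv' : u 0 * v 0 + u 1 * v 1 + u 2 * v 2 = 0 := by rw [← inner_fin3, huv]
  obtain ⟨c0, c1, c2⟩ := cross_fin3 u v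
  obtain ⟨d0, d1, d2⟩ := cross_fin3 (cross u v) u
  ext i
  fin_cases i
  · simp only [Fin.zero_eta]; rw [d0, c1, c2]; linear_combination v 0 * hu2 - u 0 * huv'
  · simp only [Fin.mk_one]; rw [d1, c0, c2]; linear_combination v 1 * hu2 - u 1 * huv'
  · simp only [Fin.reduceFinMk]; rw [d2, c0, c1]; linear_combination v 2 * hu2 - u 2 * huv'

/-- For orthonormal `u, v`: `(u × v) × v = −u`. -/
theorem cross_cross_right_of_orthonormal (hv : ‖v‖ = 1) (huv : ⟪u, v⟫ = 0) : cross (cross u v) v = -u := by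
  have hv2 : v 0 ^ 2 + v 1 ^ 2 + v 2 ^ 2 = 1 := by rw [← norm_sq_fin3, hv, one_pow]
  have huv' : u 0 * v 0 + u 1 * v 1 + u 2 * v 2 = 0 := by rw [← inner_fin3, huv]
  obtain ⟨c0, c1, c2⟩ := cross_fin3 u v
  obtain ⟨d0, d1, d2⟩ := cross_fin3 (cross u v) v
  ext i
  fin_cases i
  · simp only [Fin.zero_eta, PiLp.neg_apply]; rw [d0, c1, c2]; linear_combination v 0 * huv' - u 0 * hv2
  · simp only [Fin.mk_one, PiLp.neg_apply]; rw [d1, c0, c2]; linear_combination v 1 * huv' - u 1 * hv2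
  · simp only [Fin.reduceFinMk, PiLp.neg_apply]; rw [d2, c0, c1]; linear_combination v 2 * huv' - u 2 * hv2

/-- The frame `(u, v, u × v)` of an orthonormal pair is orthonormal. -/
theorem orthonormal_frameVec (hu : ‖u‖ = 1) (hv : ‖v‖ = 1) (huv : ⟪u, v⟫ = 0) : Orthonormal ℝ (frameVec u v) := by
  classical
  rw [orthonormal_iff_ite]
  have hn : ‖cross u v‖ = 1 := by
    have h : ‖cross u v‖ ^ 2 = 1 ^ 2 := by rw [norm_cross_sq, hu, hv, huv]; norm_num
    exact (sq_eq_sq₀ (norm_nonneg _) zero_le_one).mp h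
  have hvu : ⟪v, u⟫ = 0 := by rw [real_inner_comm, huv]
  have h1 := inner_cross_self_left u v
  have h2 := inner_cross_self_right u v
  have h1' : ⟪u, cross u v⟫ = 0 := by rw [real_inner_comm, h1]
  have h2' : ⟪v, cross u v⟫ = 0 := by rw [real_inner_comm, h2]
  intro i j
  fin_cases i <;> fin_cases j <;> simp [frameVec, huv, hvu, h1, h2, h1', h2', hu, hv, hn]

/-- The frame as an orthonormal basis of `ℝ³`. -/
def frameBasis (hu : ‖u‖ = 1) (hv : ‖v‖ = 1) (huv : ⟪u, v⟫ = 0) : OrthonormalBasis (Fin 3) ℝ E3 :=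
  OrthonormalBasis.mk (orthonormal_frameVec hu hv huv) (by
    rw [(orthonormal_frameVec hu hv huv).linearIndependent.span_eq_top_of_card_eq_finrank' (by simp)])

/-- The frame basis vectors are `(u, v, u × v)`. [folklore] -/
theorem frameBasis_apply (hu : ‖u‖ = 1) (hv : ‖v‖ = 1) (huv : ⟪u, v⟫ = 0) (i : Fin 3) :
    frameBasis hu hv huv i = frameVec u v i := by
  rw [frameBasis, OrthonormalBasis.coe_mk]

/-- The frame isometry `R : ℝ³ ≃ ℝ³`, `R w = (⟪u,w⟫, ⟪v,w⟫, ⟪u×v,w⟫)`; its inverse sends `y ↦ y₀u + y₁v + y₂(u×v)`. -/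
def frameIso (hu : ‖u‖ = 1) (hv : ‖v‖ = 1) (huv : ⟪u, v⟫ = 0) : E3 ≃ₗᵢ[ℝ] E3 := (frameBasis hu hv huv).repr

/-- Coordinates in the frame: `(R w)ᵢ = ⟪bᵢ, w⟫`. [folklore] -/
theorem frameIso_apply (hu : ‖u‖ = 1) (hv : ‖v‖ = 1) (huv : ⟪u, v⟫ = 0) (w : E3) (i : Fin 3) :
    frameIso hu hv huv w i = ⟪frameVec u v i, w⟫ := by
  rw [frameIso, OrthonormalBasis.repr_apply_apply, frameBasis_apply]

/-- Inverse frame map: `R⁻¹ y = y₀u + y₁v + y₂(u×v)`. [folklore] -/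
theorem frameIso_symm_apply (hu : ‖u‖ = 1) (hv : ‖v‖ = 1) (huv : ⟪u, v⟫ = 0) (y : E3) :
    (frameIso hu hv huv).symm y = y 0 • u + y 1 • v + y 2 • cross u v := by
  rw [frameIso, ← OrthonormalBasis.sum_repr_symm, Fin.sum_univ_three, frameBasis_apply, frameBasis_apply, frameBasis_apply]
  rfl

/-- **Triple products through the frame**: `⟪Ra, Rb × Rc⟫ = ⟪u, v × (u×v)⟫ · ⟪a, b × c⟫` (product of determinants). -/
theorem inner_cross_frameIso (hu : ‖u‖ = 1) (hv : ‖v‖ = 1) (huv : ⟪u, v⟫ = 0) (a b c : E3) :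
    ⟪frameIso hu hv huv a, cross (frameIso hu hv huv b) (frameIso hu hv huv c)⟫
      = ⟪u, cross v (cross u v)⟫ * ⟪a, cross b c⟫ := by
  set R := frameIso hu hv huv with hR
  obtain ⟨c0, c1, c2⟩ := cross_fin3 (R b) (R c)
  obtain ⟨d0, d1, d2⟩ := cross_fin3 b c
  obtain ⟨n0, n1, n2⟩ := cross_fin3 u v
  obtain ⟨m0, m1, m2⟩ := cross_fin3 v (cross u v)
  rw [inner_fin3, c0, c1, c2, inner_fin3 u, m0, m1, m2, inner_fin3 a, d0, d1, d2]
  simp only [hR, frameIso_apply, frameVec_zero, frameVec_one, frameVec_two, inner_fin3, n0, n1, n2]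
  ring

variable {H : E3 → ℝ} {l : ℕ}

/-- The rotated function `K = H ∘ R⁻¹` is smooth. -/
theorem contDiff_comp_frameIso_symm (hu : ‖u‖ = 1) (hv : ‖v‖ = 1) (huv : ⟪u, v⟫ = 0) (hH : ContDiff ℝ (⊤ : ℕ∞) H) :
    ContDiff ℝ (⊤ : ℕ∞) (fun y => H ((frameIso hu hv huv).symm y)) :=
  hH.comp (frameIso hu hv huv).symm.contDiff

/-- The rotated function is homogeneous of the same degree. -/
theorem homogeneous_comp_frameIso_symm (hu : ‖u‖ = 1) (hv : ‖v‖ = 1) (huv : ⟪u, v⟫ = 0)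
    (hhom : ∀ (c : ℝ) (y : E3), H (c • y) = c ^ l * H y) (c : ℝ) (y : E3) :
    H ((frameIso hu hv huv).symm (c • y)) = c ^ l * H ((frameIso hu hv huv).symm y) := by
  rw [LinearIsometryEquiv.map_smul, hhom]

/-- The rotated function is harmonic. -/
theorem harmonic_comp_frameIso_symm (hu : ‖u‖ = 1) (hv : ‖v‖ = 1) (huv : ⟪u, v⟫ = 0)
    (hharm : ∀ y, Laplacian.laplacian H y = 0) (y : E3) :
    Laplacian.laplacian (fun y => H ((frameIso hu hv huv).symm y)) y = 0 := by
  rw [Literature.Analysis.FluidPDE.laplacian_comp_linearIsometryEquiv_symm, hharm]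

/-- Gradient of the rotated function: `∇K(y) = R ∇H(R⁻¹y)`. -/
theorem gradient_comp_frameIso_symm (hu : ‖u‖ = 1) (hv : ‖v‖ = 1) (huv : ⟪u, v⟫ = 0) (y : E3) :
    gradient (fun y => H ((frameIso hu hv huv).symm y)) y = frameIso hu hv huv (gradient H ((frameIso hu hv huv).symm y)) :=
  Literature.Analysis.FluidPDE.gradient_comp_linearIsometryEquiv_symm _ H y

/-- `‖∇K‖² = ‖∇H‖² ∘ R⁻¹`. -/
theorem norm_gradient_sq_comp_frameIso_symm (hu : ‖u‖ = 1) (hv : ‖v‖ = 1) (huv : ⟪u, v⟫ = 0) :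
    (fun w : E3 => ‖gradient (fun y => H ((frameIso hu hv huv).symm y)) w‖ ^ 2)
      = fun w => (fun x => ‖gradient H x‖ ^ 2) ((frameIso hu hv huv).symm w) := by
  funext w
  rw [gradient_comp_frameIso_symm, LinearIsometryEquiv.norm_map]

/-- Gradient of `‖∇K‖²`: `∇‖∇K‖²(y) = R ∇‖∇H‖²(R⁻¹y)`. -/
theorem gradient_normsq_comp_frameIso_symm (hu : ‖u‖ = 1) (hv : ‖v‖ = 1) (huv : ⟪u, v⟫ = 0) (y : E3) :
    gradient (fun w : E3 => ‖gradient (fun y => H ((frameIso hu hv huv).symm y)) w‖ ^ 2) y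
      = frameIso hu hv huv (gradient (fun x : E3 => ‖gradient H x‖ ^ 2) ((frameIso hu hv huv).symm y)) := by
  rw [norm_gradient_sq_comp_frameIso_symm]
  exact Literature.Analysis.FluidPDE.gradient_comp_linearIsometryEquiv_symm _ (fun x : E3 => ‖gradient H x‖ ^ 2) y

/-- The rotated function is det-zonal if `H` is. -/
theorem detZonal_comp_frameIso_symm (hu : ‖u‖ = 1) (hv : ‖v‖ = 1) (huv : ⟪u, v⟫ = 0)
    (hdet : ∀ x : E3, x ≠ 0 → ⟪gradient H x, cross (gradient (fun w : E3 => ‖gradient H w‖ ^ 2) x) x⟫ = 0)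
    (y : E3) (hy : y ≠ 0) :
    ⟪gradient (fun y => H ((frameIso hu hv huv).symm y)) y,
      cross (gradient (fun w : E3 => ‖gradient (fun y => H ((frameIso hu hv huv).symm y)) w‖ ^ 2) y) y⟫ = 0 := by
  have hx : (frameIso hu hv huv).symm y ≠ 0 := by
    intro h
    apply hy
    have := congrArg (frameIso hu hv huv) h
    simpa using this
  have key := inner_cross_frameIso hu hv huv (gradient H ((frameIso hu hv huv).symm y))
    (gradient (fun w : E3 => ‖gradient H w‖ ^ 2) ((frameIso hu hv huv).symm y)) ((frameIso hu hv huv).symm y)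
  rw [LinearIsometryEquiv.apply_symm_apply, hdet _ hx, mul_zero] at key
  rw [gradient_normsq_comp_frameIso_symm, gradient_comp_frameIso_symm]
  exact key

/-- `(u × v) × x = ⟪u,x⟫ v − ⟪v,x⟫ u` realised through the frame: `R⁻¹(e₂ × R x) = (u × v) × x`. -/
theorem frameIso_symm_cross_single_two (hu : ‖u‖ = 1) (hv : ‖v‖ = 1) (huv : ⟪u, v⟫ = 0) (x : E3) :
    (frameIso hu hv huv).symm (cross (EuclideanSpace.single 2 (1 : ℝ)) (frameIso hu hv huv x)) = cross (cross u v) x := by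
  rw [frameIso_symm_apply]
  obtain ⟨c0, c1, c2⟩ := cross_fin3 (EuclideanSpace.single 2 (1 : ℝ)) (frameIso hu hv huv x)
  obtain ⟨n0, n1, n2⟩ := cross_fin3 u v
  obtain ⟨d0, d1, d2⟩ := cross_fin3 (cross u v) x
  have hR : ∀ i, frameIso hu hv huv x i = ⟪frameVec u v i, x⟫ := frameIso_apply hu hv huv x
  ext i
  simp only [PiLp.add_apply, PiLp.smul_apply, smul_eq_mul, c0, c1, c2, hR, frameVec_zero, frameVec_one, frameVec_two,
    inner_fin3]
  fin_cases i <;> simp [d0, d1, d2, n0, n1, n2] <;> ring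

/-- **Back-transfer of rotation invariance**: if `K = H ∘ R⁻¹` is annihilated by the rotation generator about `e₂`, then `H` is annihilated
by the rotation generator about `n = u × v`. -/
theorem inner_cross_gradient_of_frame (hu : ‖u‖ = 1) (hv : ‖v‖ = 1) (huv : ⟪u, v⟫ = 0)
    (hK : ∀ y : E3, ⟪cross (EuclideanSpace.single 2 (1 : ℝ)) y, gradient (fun y => H ((frameIso hu hv huv).symm y)) y⟫ = 0)
    (x : E3) : ⟪cross (cross u v) x, gradient H x⟫ = 0 := by
  have h := hK (frameIso hu hv huv x)
  rw [gradient_comp_frameIso_symm, LinearIsometryEquiv.symm_apply_apply] at h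
  have h2 : ⟪(frameIso hu hv huv).symm (cross (EuclideanSpace.single 2 (1 : ℝ)) (frameIso hu hv huv x)), gradient H x⟫ = 0 := by
    rw [← (frameIso hu hv huv).inner_map_map, LinearIsometryEquiv.apply_symm_apply]
    exact h
  rwa [frameIso_symm_cross_single_two] at h2

end Frame

end Summit.NavierStokesRegularity.NavierStokesRegularity.Theorems.PoloidalLiouville.HorizonTower.Zonal

end
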